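import Literature.MathematicalPhysics.QuantumFieldTheory.Balaban1983to89.B6Ineq2118TwoScaleV1
import Literature.MathematicalPhysics.QuantumFieldTheory.Balaban1983to89.B12Eq440TorusKernel

/-!
# `Balaban1983to89.B6DeltaJKernelTwoScaleV1` — T. Bałaban, *Propagators and renormalization transformations for lattice gauge
# theories. II*, Commun. Math. Phys. **96** (1984) 223–250 [Balaban1984PropagatorsII], (2.118) p. 243 with p. 250: *«C is a short-ranged
# operator, so C*Δ_kC has the same exponential decay as Δ_k»* — THE KERNEL OF THE CONCRETE `Δ_j` OF THE TWO-SCALE DATA `tsV1` IN THE BOND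
# BASIS IS `κ·Re K^T` OF THE TORUS KERNEL OF RECORD (p10's `B12Eq440TorusKernel.torKer`), HENCE DECAYS EXPONENTIALLY, uniformly in the volume

statement-level skeleton of published theorems with citation tags; proofs where landed; nothing here is a claim about the Yang–Mills mass gap

PDF held: `paper:balaban1984-cmp96-propagators-rt-ii` (journal page = PDF page + 222; p. 243 [PDF 21] text layer; p. 246 [PDF 24] and p. 250
[PDF 28] read AS IMAGE on the ×2 renders `run/shared/lean/pub/pub-balaban/b2b-balaban-ref1/pages/1984-cmp96-propagators-rt-II/…-p024-x2.png`,
2026-08-22).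

PRINT (verbatim).  p. 243: *"the quadratic forms are equal to ⟨B, Δ_jB⟩ given by (1.66) and satisfying (1.67)"*; p. 246: *"This implies that a
covariance C̃^{(j)}_Λ of the Gaussian integral in (2.119) is bounded from above by a positive constant dependent on d and L only, and it has an
exponential decay with a decay rate having the same property."*; p. 250: *"C is a short-ranged operator, so C*Δ_kC has the same exponential decay
as Δ_k."*

CITATION HEADER (lean-in-tree rule) — WHAT IS REPRODUCED.  Phase-2 file of the `lit-balaban` typed skeleton (HOME
`run/shared/lean/pub/lit-balaban/`), seat **p22 gen 12** (B6 fold owner r03, referee ref-4; lane = the Sect. C chain (2.95)–(2.147) on the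
concrete two-scale data `tsV1`).  SKELETON rows **B6.Eq2.118** / **B6.Txt@246** (the «exponential decay» clause of the C̃-sentence — INPUT: the
decay of the kernel of the concrete `Δ_j`; successor files assemble the Combes–Thomas route for `C̃^{(j)}_Λ = covOp Ax (Q″*aQ″ + Δ_j)`).
IMPORTS BY NAME: gen 10's `…B6Ineq2118TwoScaleV1.inner_Δj_eq_tower` (`⟨B, Δ_jB⟩_{tsV1} = κ⟨B̃, Δ_j^{tower}B̃⟩`, `κ = c²/(η^dL^{2j})`), gen 8's
`…B6SectCPositivity.Δj_symm`, r02's `…B5Eq114Gauss.DeltaK_symm`, p10's `…B12Eq440TorusKernel.DeltaK_apply_eq_sum` (the (1.19)/(1.65) torus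
operator of record acts by convolution with `Re K^T`, `K^T = torKer`) and `torKer_toT_eq_torusKernel`, `…B12Eq443LatticeMoments.stripRegular_symbC`
(strip datum, constants `MC`, `κ₁₆₆`), pv17's engine `…B4TorusKernel.MultiPeriod.torusKernel_descend_decay_torusMetric`.  THIS FILE:
* §1 **`inner_Δj_eq_tower₂`**: POLARIZATION of gen 10's quadratic identity — `⟨A, Δ_jB⟩_{tsV1} = κ·⟨Ã, Δ_j^{tower}B̃⟩` for all `A, B`;
* §2 **`inner_tB_single_DeltaK`**: `⟨ẽ_b, Δ_j^{tower}ẽ_{b′}⟩ = Re K^T_{μ(b′)μ(b)}(x_b − x_{b′})`; **`inner_single_Δj_single`**: THE KERNEL of the concrete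
  `Δ_j` in the bond basis of `ℓ²(T^{(j)})` is `⟨e_b, Δ_je_{b′}⟩ = κ·Re K^T_{μ(b′)μ(b)}(x_b − x_{b′})`;
* §3 (dimension written `d + 1`, parameter set `⟨d + 1, L, m, K, _, _⟩` — every `P : Params` has this form) **`abs_torKer_re_le`** and
  **`kernel_Δj_decay`**: `|⟨e_b, Δ_je_{b′}⟩| ≤ κ·M_C(d+1, κ₁₆₆)·periodConst(κ₁₆₆, d)·e^{−(κ₁₆₆(d+1)/(d+1))|x_b − x_{b′}|_T}` (torus sup-metric of the
  lattice representatives of the source sites) — uniformly in the volume, in `Λ′` and in the weights.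
THEOREMS ONLY (no definition, no `def … : Prop` fact); standard axioms.  HONEST SCOPE: an ENTRY bound for gen 7's typed `Δ_j = H_j*(Δ − ∂P_j∂*)H_j`
of `tsV1 hc Λ′ w` (`c ≠ 0`, `j + 1 ≤ m + K`, `w > 0`; `Δ_j` does not depend on `Λ′, w`), through the (1.19) torus operator of record and p10's
kernel; crude d-only constants of that lineage times the V1 normalisation `κ`; finite tori of the V1 calculus; NOT summit progress.
-/

noncomputable section

open scoped InnerProductSpace
open Finset

namespace Literature.MathematicalPhysics.QuantumFieldTheory.Balaban1983to89.B6DeltaJKernelTwoScaleV1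

open LatticeFieldCalculus B6SectAOperatorsV1 B6SectCTwoScaleV1 B6SectCTwoScaleV1Lattice
open B6SectCOperators (TwoScaleData)
open B6SectCPositivity (Δj_symm)
open B5SectBStatements (Fld eta)
open B5Eq117TorusCarriers (Mk tB tB_apply)
open B5Prop11Plancherel (Tor)
open B5Eq114Gauss (DeltaK_symm)
open B6Ineq2118TwoScaleV1 (inner_Δj_eq_tower)
open B12Eq440TorusKernel (torKer DeltaK_apply_eq_sum torKer_toT_eq_torusKernel)
open B12Eq443LatticeMoments (MC stripRegular_symbC)
open B5Symbol166Strip (kappa166 kappa166_pos)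
open B4TorusKernel (periodConst)
open B4TorusKernel.MultiPeriod (torusSupNorm torusKernel_descend_decay_torusMetric)
open B6LowerBound2153Torus (toT rep toT_rep)
open B5Kernel166Decay (toT_sub)
open B6Cov2156Torus (one_le_M)

/-! ## §1  Polarization of `⟨B, Δ_jB⟩ = κ⟨B̃, Δ_j^{tower}B̃⟩` -/

section V1

variable {P : Params} {c : ℝ} (hc : c ≠ 0) {j : ℕ} (hj : j + 1 ≤ P.m + P.K) (Λ' : Finset (Site P (j + 1)))
  {w : CIdx j Λ' → ℝ} (hw : ∀ i, 0 < w i)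

include hj hw in
/-- **POLARIZATION**: `⟨A, Δ_jB⟩_{tsV1} = κ·⟨Ã, Δ_j^{tower}B̃⟩` for all unit-lattice bond fields `A, B` (`κ = c²/(η^dL^{2j})`, `B̃ = tB B` the
transport to the torus carriers, `Δ_j^{tower} = B5Eq114Gauss.DeltaK L (Mk P j) j` the (1.19)/(1.65) operator of record) — both sides are
symmetric bilinear forms (`Δj_symm`, `DeltaK_symm`) with equal quadratic forms (gen 10's `inner_Δj_eq_tower`).
[cite: Balaban1984PropagatorsII, (2.118) p.243] -/
theorem inner_Δj_eq_tower₂ (A B : VecField P j ℝ) :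
    ⟪WithLp.toLp 2 A, (tsV1 hc Λ' w).Δj (WithLp.toLp 2 B)⟫_ℝ =
      c ^ 2 / (eta P.L j ^ P.d * ((P.L : ℝ) ^ j) ^ 2) *
        ⟪tB (P := P) (k := j) A, B5Eq114Gauss.DeltaK P.L (Mk P j) j (tB (P := P) (k := j) B)⟫_ℝ := by
  have hq : ∀ X : VecField P j ℝ, ⟪WithLp.toLp 2 X, (tsV1 hc Λ' w).Δj (WithLp.toLp 2 X)⟫_ℝ =
      c ^ 2 / (eta P.L j ^ P.d * ((P.L : ℝ) ^ j) ^ 2) *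
        ⟪tB (P := P) (k := j) X, B5Eq114Gauss.DeltaK P.L (Mk P j) j (tB (P := P) (k := j) X)⟫_ℝ :=
    fun X => inner_Δj_eq_tower hc hj Λ' hw X
  have hTs : ⟪WithLp.toLp 2 B, (tsV1 hc Λ' w).Δj (WithLp.toLp 2 A)⟫_ℝ = ⟪WithLp.toLp 2 A, (tsV1 hc Λ' w).Δj (WithLp.toLp 2 B)⟫_ℝ := by
    rw [real_inner_comm, Δj_symm (isLattice Λ' hc hj hw)]
  have hDs : ⟪tB (P := P) (k := j) B, B5Eq114Gauss.DeltaK P.L (Mk P j) j (tB (P := P) (k := j) A)⟫_ℝ =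
      ⟪tB (P := P) (k := j) A, B5Eq114Gauss.DeltaK P.L (Mk P j) j (tB (P := P) (k := j) B)⟫_ℝ := by
    rw [real_inner_comm, DeltaK_symm]
  have h := hq (A + B)
  rw [WithLp.toLp_add, map_add, inner_add_left, inner_add_right, inner_add_right, map_add (tB (P := P) (k := j)), map_add,
    inner_add_left, inner_add_right, inner_add_right, hq A, hq B, hTs, hDs] at h
  linarith

/-! ## §2  The kernel in the bond basis -/

omit hc in
/-- the transported basis field `ẽ_{⟨x,μ⟩}` is the indicator of `(x, μ)` on the torus carriers. [cite: Balaban1984PropagatorsI, (1.17) p.20] -/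
theorem tB_single_apply [DecidableEq (PBond P j)] (x : Tor (Mk P j)) (μ : Fin P.d) (i : Tor (Mk P j) × Fin P.d) :
    tB (P := P) (k := j) (Pi.single (⟨x, μ⟩ : PBond P j) (1 : ℝ)) i = if i = (x, μ) then 1 else 0 := by
  rw [tB_apply]
  by_cases hi : i = (x, μ)
  · rw [if_pos hi, hi]
    exact Pi.single_eq_same _ _
  · rw [if_neg hi]
    refine Pi.single_eq_of_ne ?_ _
    intro h
    apply hi
    rcases i with ⟨x', μ'⟩
    simp only [PBond.mk.injEq] at h
    exact Prod.ext h.1 h.2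

omit hc in
/-- **the matrix element of the torus operator of record at two basis fields**: `⟨ẽ_{⟨x,μ⟩}, Δ_j^{tower}ẽ_{⟨y,ν⟩}⟩ = Re K^T_{νμ}(x − y)`
(`K^T = torKer (L^j) (Mk P j)`, p10's `DeltaK_apply_eq_sum`). [cite: Balaban1984PropagatorsII, (2.118) p.243] -/
theorem inner_tB_single_DeltaK [DecidableEq (PBond P j)] (x y : Tor (Mk P j)) (μ ν : Fin P.d) :
    ⟪tB (P := P) (k := j) (Pi.single (⟨x, μ⟩ : PBond P j) 1),
        B5Eq114Gauss.DeltaK P.L (Mk P j) j (tB (P := P) (k := j) (Pi.single (⟨y, ν⟩ : PBond P j) 1))⟫_ℝ =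
      (torKer (P.L ^ j) (Mk P j) ν μ (x - y)).re := by
  rw [PiLp.inner_apply, Fintype.sum_eq_single ((x, μ) : Tor (Mk P j) × Fin P.d)]
  · rw [DeltaK_apply_eq_sum, Fintype.sum_eq_single y]
    · rw [Fintype.sum_eq_single ν]
      · simp only [RCLike.inner_apply, conj_trivial, tB_single_apply, ite_true, mul_one]
      · intro ν' hν'
        rw [tB_single_apply, if_neg (by intro h; exact hν' (Prod.mk.inj h).2), mul_zero]
    · intro y' hy'
      refine Finset.sum_eq_zero fun ν' _ => ?_
      rw [tB_single_apply, if_neg (by intro h; exact hy' (Prod.mk.inj h).1), mul_zero]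
  · intro i hi
    simp only [RCLike.inner_apply, conj_trivial, tB_single_apply, if_neg hi, mul_zero]

include hj hw in
/-- **THE KERNEL OF THE CONCRETE `Δ_j` IN THE BOND BASIS of `ℓ²(T^{(j)})`**: `⟨e_{⟨x,μ⟩}, Δ_je_{⟨y,ν⟩}⟩ = κ·Re K^T_{νμ}(x − y)`,
`κ = c²/(η^dL^{2j})`. [cite: Balaban1984PropagatorsII, (2.118) p.243] -/
theorem inner_single_Δj_single [DecidableEq (PBond P j)] (x y : Tor (Mk P j)) (μ ν : Fin P.d) :
    ⟪EuclideanSpace.single (⟨x, μ⟩ : PBond P j) (1 : ℝ), (tsV1 hc Λ' w).Δj (EuclideanSpace.single (⟨y, ν⟩ : PBond P j) (1 : ℝ))⟫_ℝ =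
      c ^ 2 / (eta P.L j ^ P.d * ((P.L : ℝ) ^ j) ^ 2) * (torKer (P.L ^ j) (Mk P j) ν μ (x - y)).re := by
  rw [← inner_tB_single_DeltaK]
  exact inner_Δj_eq_tower₂ hc hj Λ' hw (Pi.single ⟨x, μ⟩ 1) (Pi.single ⟨y, ν⟩ 1)

end V1

/-! ## §3  The decay of the torus kernel and of the kernel of the concrete `Δ_j` -/

section Decay

/-! p10's periodisation dictionary and pv17's decay engine are written with the dimension as `d + 1`; accordingly the parameter set is written
here as `⟨d + 1, L, m, K, _, _⟩` — EVERY `P : Params` is of this form (`P.hd : 1 ≤ P.d`; destructure `P` to apply). -/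

/-- **DECAY OF THE TORUS KERNEL OF RECORD**: `|Re K^T_{μν}(x̄)| ≤ M_C(d+1, κ₁₆₆)·periodConst(κ₁₆₆, d)·e^{−(κ₁₆₆/(d+1))|x|_T}` for every lattice point
`x ∈ ℤ^{d+1}`, every `n ≥ 1` and every period vector (`torKer_toT_eq_torusKernel` + `torusKernel_descend_decay_torusMetric` with the strip datum
`stripRegular_symbC`). [cite: Balaban1984PropagatorsII, p.250 (text before (2.157))] -/
theorem abs_torKer_re_le {d : ℕ} (n : ℕ) [NeZero n] (M : Fin (d + 1) → ℕ) [∀ μ, NeZero (M μ)] (μ ν : Fin (d + 1))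
    (x : Fin (d + 1) → ℤ) :
    |(torKer n M μ ν (toT M x)).re| ≤ MC (d + 1) (kappa166 (d + 1)) * periodConst (kappa166 (d + 1)) d *
      Real.exp (-(kappa166 (d + 1) / (d + 1) * torusSupNorm M x)) := by
  rw [torKer_toT_eq_torusKernel]
  exact (Complex.abs_re_le_norm _).trans
    (torusKernel_descend_decay_torusMetric (stripRegular_symbC n μ ν (kappa166_pos _).le le_rfl) (kappa166_pos _) (one_le_M M) x)

variable {d L m K : ℕ} {hd : 1 ≤ d + 1} {hL : Odd L ∧ 1 < L} {c : ℝ} (hc : c ≠ 0) {j : ℕ}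
  (Λ' : Finset (Site (⟨d + 1, L, m, K, hd, hL⟩ : Params) (j + 1))) {w : CIdx j Λ' → ℝ} (hw : ∀ i, 0 < w i)

include hw in
/-- **«… THE SAME EXPONENTIAL DECAY AS Δ_k» FOR THE CONCRETE `Δ_j` OF THE TWO-SCALE DATA**, torus-point form: on the unit torus `T^{(j)}` of the
parameter set `(d + 1, L, m, K)`, `|⟨e_{⟨x,μ⟩}, Δ_je_{⟨y,ν⟩}⟩| ≤ κ·M_C(d+1, κ₁₆₆)·periodConst(κ₁₆₆, d)·e^{−(κ₁₆₆(d+1)/(d+1))·|x − y|_T}` (torus sup-metric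
of the box representatives; `κ = c²/(η^{d+1}L^{2j})`) — uniformly in the volume, in `Λ′` and in the weights.
[cite: Balaban1984PropagatorsII, p.250 (text before (2.157))] -/
theorem kernel_Δj_decay_tor [DecidableEq (PBond (⟨d + 1, L, m, K, hd, hL⟩ : Params) j)] (hj : j + 1 ≤ m + K)
    (x y : Tor (Mk (⟨d + 1, L, m, K, hd, hL⟩ : Params) j)) (μ ν : Fin (d + 1)) :
    |⟪EuclideanSpace.single (⟨x, μ⟩ : PBond (⟨d + 1, L, m, K, hd, hL⟩ : Params) j) (1 : ℝ),
        (tsV1 hc Λ' w).Δj (EuclideanSpace.single (⟨y, ν⟩ : PBond (⟨d + 1, L, m, K, hd, hL⟩ : Params) j) (1 : ℝ))⟫_ℝ| ≤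
      c ^ 2 / (eta L j ^ (d + 1) * ((L : ℝ) ^ j) ^ 2) *
        (MC (d + 1) (kappa166 (d + 1)) * periodConst (kappa166 (d + 1)) d *
          Real.exp (-(kappa166 (d + 1) / (d + 1) *
            torusSupNorm (Mk ⟨d + 1, L, m, K, hd, hL⟩ j) (rep (Mk ⟨d + 1, L, m, K, hd, hL⟩ j) x - rep (Mk ⟨d + 1, L, m, K, hd, hL⟩ j) y)))) := by
  haveI : NeZero ((⟨d + 1, L, m, K, hd, hL⟩ : Params).L ^ j) := ⟨pow_ne_zero _ (show L ≠ 0 by have := hL.2; omega)⟩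
  have hκ := (B6Ineq2118TwoScaleV1.kappa_pos (P := (⟨d + 1, L, m, K, hd, hL⟩ : Params)) hc (j := j)).le
  rw [inner_single_Δj_single hc hj Λ' hw x y μ ν, abs_mul, abs_of_nonneg hκ]
  refine mul_le_mul_of_nonneg_left ?_ hκ
  have h := abs_torKer_re_le ((⟨d + 1, L, m, K, hd, hL⟩ : Params).L ^ j) (Mk ⟨d + 1, L, m, K, hd, hL⟩ j) ν μ
    (rep (Mk ⟨d + 1, L, m, K, hd, hL⟩ j) x - rep (Mk ⟨d + 1, L, m, K, hd, hL⟩ j) y)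
  rwa [← toT_sub, toT_rep, toT_rep] at h

include hw in
/-- **THE SAME FOR ARBITRARY BONDS `b, b′`**: `|⟨e_b, Δ_je_{b′}⟩| ≤ κ·M_C(d+1, κ₁₆₆)·periodConst(κ₁₆₆, d)·e^{−(κ₁₆₆(d+1)/(d+1))·|x_b − x_{b′}|_T}` (the
source sites). [cite: Balaban1984PropagatorsII, p.250 (text before (2.157))] -/
theorem kernel_Δj_decay [DecidableEq (PBond (⟨d + 1, L, m, K, hd, hL⟩ : Params) j)] (hj : j + 1 ≤ m + K)
    (b b' : PBond (⟨d + 1, L, m, K, hd, hL⟩ : Params) j) :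
    |⟪EuclideanSpace.single b (1 : ℝ), (tsV1 hc Λ' w).Δj (EuclideanSpace.single b' (1 : ℝ))⟫_ℝ| ≤
      c ^ 2 / (eta L j ^ (d + 1) * ((L : ℝ) ^ j) ^ 2) *
        (MC (d + 1) (kappa166 (d + 1)) * periodConst (kappa166 (d + 1)) d *
          Real.exp (-(kappa166 (d + 1) / (d + 1) *
            torusSupNorm (Mk ⟨d + 1, L, m, K, hd, hL⟩ j)
              (rep (Mk ⟨d + 1, L, m, K, hd, hL⟩ j) b.src - rep (Mk ⟨d + 1, L, m, K, hd, hL⟩ j) b'.src)))) :=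
  kernel_Δj_decay_tor hc Λ' hw hj b.src b'.src b.dir b'.dir

end Decay

end Literature.MathematicalPhysics.QuantumFieldTheory.Balaban1983to89.B6DeltaJKernelTwoScaleV1

end
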